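import Literature.MathematicalPhysics.QuantumFieldTheory.Balaban1983to89.Beta.AveragingMixedJetTables

/-!
# `BalabanUV.Beta.RootedGaugeCovariance` — binder row D1, «GAUGE-LETTERS» (G1): **THE MOTHER IDENTITY FOR THE ROOTED ONE-STEP AVERAGING** —
# group-level background-gauge covariance of node 12b's `PhiGAt ρ` (B7 (11) «Ū^u = (Ū)^u», rooted), EXACTLY, over any ring
# (β sub-cell, BINDER-OWNERS row D1 OWNER, lineage an2 gen 21)

HONEST FRAMING (cell charter, verbatim): «discharging BetaPertH makes Balaban's UV stability UNCONDITIONAL — a real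
constructive-QFT result; it is NOT the continuum limit and NOT the Clay problem.»
HONEST DEPENDENCY: continuum YM on T⁴ ⇐ BetaPertH ∧ nine spine estimates (0/9 proved); BetaPertH ⇐ (D1) ∧ (D4) ∧ CAP+tail;
G-an2-4 gates asym, D1 and NE2/3/4.
DERIVED cell leaf ([folklore] telescoping along node 5ρ's rooted letter lists + conjugation-equivariance of the truncated series, BY NAME over
node 12 `AveragingThirdJet` (`Tel`, `gaugeF`∕`gaugeB`, `tel_axial`, `tel_segUp`, `tel_rev_segUp`, `logT_conj`, `expT_conj`) and node 12b
`AveragingMixedJetTables.PhiGAt`).  The unrooted statement is node 12's `PhiG_gauge`; this file is its ROOTED twin (root `L·y + ρ` instead of `L·y`).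
No statement of Bałaban's papers is asserted (B7 (11) is an object LOCATOR only), no `[cite:]`, no `def`, no `Prop` fact.  First module of the
owner's route to the hW-side bond-level Ward laws (WB-bond)∕(WM-bond) of `RowD1JointEnd`∕`MixedWardPacking`∕`BorderWardPacking` (journal
«GAUGE-LETTERS» (G1)–(G4)); discharges NO letter by itself; 0∕4 binders (hW, hR, D1Tel, D1Rep).  NOT D1, NOT `BetaPertH`, NOT continuum, NOT Clay.

WHAT (any ring `R` that is a `𝕜`-algebra, any pair of site functions `u`, `ub` with `u·ub = ub·u = 1` pointwise, any transporter pair `G`, `Ḡ`):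
* §1 telescoping along the rooted lists: `tel_gammaCAt` (`Γ^ρ_{c,x}` from the root `r = L·y + ρ` to `r + L·e_μ`), `tel_cSegAt` (the rooted straight
  bond), `tel_loopCAt` (the rooted closed loop: conjugation by `u(r)`).
* §2 **`PhiGAt_gauge`**: `PhiGAt 𝕜 ρ (gaugeF u ub G) (gaugeB u ub Ḡ) L μ y = u r · PhiGAt 𝕜 ρ G Ḡ L μ y · ub (r + L·e_μ)`, `r = L·y + ρ` — EXACT, no
  smallness, no commutativity, no nilpotency; and the REFERENCE form `PhiGAt_gauge_conj` for a loop-closing pair (`… · ub r` when the two ends are read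
  at the root: `u r · (PhiGAt … · hol) · ub r` shape used by the jets).
Provenance: β sub-cell, unit beta-an2 gen 21, 2026-08-20 (v1); no existing file touched.
-/

namespace Summit.QuantumFields.BalabanUV.Beta.RootedGaugeCovariance

open Finset
open Literature.MathematicalPhysics.QuantumFieldTheory.Balaban1983to89.Beta
open Literature.MathematicalPhysics.QuantumFieldTheory.Balaban1983to89.Beta.AffineAveraging
open Literature.MathematicalPhysics.QuantumFieldTheory.Balaban1983to89.Beta.AveragingContours
open Literature.MathematicalPhysics.QuantumFieldTheory.Balaban1983to89.Beta.AveragingContoursRooted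
open Literature.MathematicalPhysics.QuantumFieldTheory.Balaban1983to89.Beta.AveragingThirdJet
open Literature.MathematicalPhysics.QuantumFieldTheory.Balaban1983to89.Beta.AveragingMixedJetTables

variable {𝕜 : Type*} [Field 𝕜] {d : ℕ} {R : Type*} [Ring R] [Algebra 𝕜 R]
variable {u ub : (Fin d → ℤ) → R} {G Gb : Form1 d R}

/-! ## §1 Telescoping along the rooted letter lists -/

section Paths

variable (hr : ∀ x, u x * ub x = 1) (hl : ∀ x, ub x * u x = 1)
include hr hl

/-- [folklore] TELESCOPING along the rooted block contour `Γ^ρ_{c,x}`: from the root `r = L·y + ρ` to `r + L·e_μ`. -/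
theorem tel_gammaCAt (ρ : Fin d → ℤ) (L : ℕ) (μ : Fin d) (y : Fin d → ℤ) (b : Fin d → ℕ) :
    Tel u ub G Gb (gammaCAt ρ δ L μ y b) ((L : ℤ) • y + ρ) ((L : ℤ) • y + ρ + (L : ℤ) • unitVec μ) := by
  unfold gammaCAt
  exact Tel.append hl (Tel.append hl (tel_axial hr hl _ _).1 (tel_segUp hr hl _ μ L))
    (tel_axial hr hl ((L : ℤ) • y + ρ + (L : ℤ) • unitVec μ)
      ((L : ℤ) • y + toSite b + (L : ℤ) • unitVec μ)).2

/-- [folklore] TELESCOPING along the rooted straight coarse bond `[r, r + L·e_μ]`. -/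
theorem tel_cSegAt (ρ : Fin d → ℤ) (L : ℕ) (μ : Fin d) (y : Fin d → ℤ) :
    Tel u ub G Gb (segUp δ ((L : ℤ) • y + ρ) μ L) ((L : ℤ) • y + ρ) ((L : ℤ) • y + ρ + (L : ℤ) • unitVec μ) :=
  tel_segUp hr hl _ μ L

/-- [folklore] TELESCOPING around the rooted closed loop `Γ^ρ_{c,x} ∪ (−c)`: conjugation by `u(r)`. -/
theorem tel_loopCAt (ρ : Fin d → ℤ) (L : ℕ) (μ : Fin d) (y : Fin d → ℤ) (b : Fin d → ℕ) :
    Tel u ub G Gb (loopCAt ρ δ L μ y b) ((L : ℤ) • y + ρ) ((L : ℤ) • y + ρ) := by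
  unfold loopCAt
  exact Tel.append hl (tel_gammaCAt hr hl ρ L μ y b) (tel_rev_segUp hr hl _ μ L)

/-! ## §2 The rooted mother identity -/

/-- [folklore] **THE ROOTED MOTHER IDENTITY** (group-level background-gauge covariance of the rooted one-step averaging, B7 (11) «Ū^u = (Ū)^u» as an
object locator; the rooted twin of node 12's `PhiG_gauge`): `Φ^ρ_b(G^u) = u(r) · Φ^ρ_b(G) · u(r + L·e_μ)⁻¹`, `r = L·y + ρ`, EXACTLY — only telescoping
along the rooted lists and the conjugation-equivariance of `logT`∕`expT`. -/
theorem PhiGAt_gauge (ρ : Fin d → ℤ) (L : ℕ) (μ : Fin d) (y : Fin d → ℤ) :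
    PhiGAt 𝕜 ρ (gaugeF u ub G) (gaugeB u ub Gb) L μ y
      = u ((L : ℤ) • y + ρ) * PhiGAt 𝕜 ρ G Gb L μ y * ub ((L : ℤ) • y + ρ + (L : ℤ) • unitVec μ) := by
  have hloop : ∀ b, holG (gaugeF u ub G) (gaugeB u ub Gb) (loopCAt ρ δ L μ y b)
      = u ((L : ℤ) • y + ρ) * holG G Gb (loopCAt ρ δ L μ y b) * ub ((L : ℤ) • y + ρ) :=
    fun b => tel_loopCAt hr hl ρ L μ y b
  have hc : holG (gaugeF u ub G) (gaugeB u ub Gb) (segUp δ ((L : ℤ) • y + ρ) μ L)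
      = u ((L : ℤ) • y + ρ) * holG G Gb (segUp δ ((L : ℤ) • y + ρ) μ L) * ub ((L : ℤ) • y + ρ + (L : ℤ) • unitVec μ) :=
    tel_cSegAt hr hl ρ L μ y
  simp only [PhiGAt, hloop, hc, logT_conj (hr _) (hl _), ← Finset.sum_mul, ← Finset.mul_sum]
  rw [smul_conj, expT_conj (hr _) (hl _), tel_mul hl]

/-- [folklore] The same with the far gauge factor moved to the left: `Φ^ρ_b(G^u) · u(r + L·e_μ) = u(r) · Φ^ρ_b(G)`. -/
theorem PhiGAt_gauge_mul (ρ : Fin d → ℤ) (L : ℕ) (μ : Fin d) (y : Fin d → ℤ) :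
    PhiGAt 𝕜 ρ (gaugeF u ub G) (gaugeB u ub Gb) L μ y * u ((L : ℤ) • y + ρ + (L : ℤ) • unitVec μ)
      = u ((L : ℤ) • y + ρ) * PhiGAt 𝕜 ρ G Gb L μ y := by
  rw [PhiGAt_gauge hr hl, mul_assoc, hl, mul_one]

end Paths

end Summit.QuantumFields.BalabanUV.Beta.RootedGaugeCovariance
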